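import Mathlib
import Literature.NumberTheory.Transcendental.EllIterRep

/-!
# `BiellipticRealPeriodCell` (stmt-KontsevichZagierPeriods-18685), line `Sketch`:
# stub `stub_invSqrtIntegrable` (B)

Absolute convergence of the real period `∫_α^β dx/√F(x)` of a squarefree `F ∈ ℚ[X]` over a
bounded component `(α, β)` of `{F > 0}` whose end points are roots of `F`, read in
`ℝ¹ = Fin 1 → ℝ` (where the Kontsevich–Zagier calculus lives).

Proof. Over `ℝ`, `F(y) = (y − α)(β − y)·R(y)` for a real polynomial `R` (divide the image of `F`
in `ℝ[X]` by `X − α` and by `X − β`); `R > 0` on `(α, β)` (sign of `F`) and `R(α) ≠ 0 ≠ R(β)`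
because `F`, squarefree over the perfect field `ℚ`, is separable, so its image in `ℝ[X]` is
squarefree and `α, β` are simple roots. Hence `|R| ≥ m > 0` on the compact `[α, β]`,
`F(y) ≥ m(y − α)(β − y) ≥ K·min(y − α, β − y)` with `K = m(β − α)/2`, and
`1/√F ≤ K^{-1/2}((√(y − α))⁻¹ + (√(β − y))⁻¹)`, an integrable majorant
(`KZ.integrableOn_inv_sqrt_sub_left/right` of `EllIterRep`, the pattern of
`KZ.EllCurve.integrableOn_inv_sqrt_f`). The statement in `ℝ¹` follows by
`volume_preserving_funUnique`. [Lawden 1989, §6.12; Kontsevich–Zagier 2001, §1.1] — folklore.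
-/

noncomputable section

namespace Summit.KontsevichZagierPeriods.IsogenyCertificates.BiellipticRealPeriodCellStubs.InvSqrtIntegrable

open Polynomial Set MeasureTheory
open Literature.NumberTheory.Transcendental

/-- If `P = (X − a)·S·Q` is squarefree then `a` is not a root of the cofactor `Q` (else `(X − a)²`
divides `P`). [folklore] -/
theorem eval_ne_zero_of_squarefree {P S Q : ℝ[X]} {a : ℝ} (hP : Squarefree P)
    (h : P = (X - C a) * S * Q) : Q.eval a ≠ 0 := by
  intro h0
  obtain ⟨Q', hQ'⟩ := dvd_iff_isRoot.mpr h0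
  have hdvd : (X - C a) * (X - C a) ∣ P := ⟨S * Q', by rw [h, hQ']; ring⟩
  exact Polynomial.not_isUnit_X_sub_C a (hP _ hdvd)

/-- **Real factorisation of a squarefree rational polynomial at two real roots.** For `F ∈ ℚ[X]`
squarefree with real roots `α ≠ β` there is a real polynomial `R` with
`F(y) = (y − α)(β − y)·R(y)` for all real `y`, and `R(α) ≠ 0`, `R(β) ≠ 0` (the roots are simple:
`F` is separable over the perfect field `ℚ`, hence squarefree over `ℝ`). [folklore] -/
theorem exists_factor {F : ℚ[X]} {α β : ℝ} (hF : Squarefree F) (hab : α ≠ β)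
    (hα : aeval α F = 0) (hβ : aeval β F = 0) :
    ∃ R : ℝ[X], (∀ y : ℝ, aeval y F = (y - α) * (β - y) * R.eval y) ∧ R.eval α ≠ 0 ∧
      R.eval β ≠ 0 := by
  obtain ⟨P, hP⟩ : ∃ P : ℝ[X], F.map (algebraMap ℚ ℝ) = P := ⟨_, rfl⟩
  have hevP : ∀ y : ℝ, aeval y F = P.eval y := fun y => by rw [← hP, eval_map_algebraMap]
  have hsqP : Squarefree P :=
    hP ▸ (PerfectField.separable_iff_squarefree.mpr hF).map.squarefree
  have hPα : P.IsRoot α := by rw [IsRoot.def, ← hevP, hα]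
  obtain ⟨P₁, hP₁⟩ : ∃ P₁ : ℝ[X], P = (X - C α) * P₁ :=
    ⟨_, (mul_divByMonic_eq_iff_isRoot.mpr hPα).symm⟩
  have hP₁β : P₁.IsRoot β := by
    have h := hevP β
    rw [hβ, hP₁, eval_mul, eval_sub, eval_X, eval_C] at h
    exact (mul_eq_zero.mp h.symm).resolve_left (sub_ne_zero.mpr hab.symm)
  obtain ⟨Q, hQ⟩ : ∃ Q : ℝ[X], P₁ = (X - C β) * Q :=
    ⟨_, (mul_divByMonic_eq_iff_isRoot.mpr hP₁β).symm⟩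
  refine ⟨-Q, fun y => ?_, ?_, ?_⟩
  · rw [hevP, hP₁, hQ]
    simp only [eval_mul, eval_sub, eval_X, eval_C, eval_neg]
    ring
  · rw [eval_neg, neg_ne_zero]
    exact eval_ne_zero_of_squarefree (S := X - C β) hsqP (by rw [hP₁, hQ]; ring)
  · rw [eval_neg, neg_ne_zero]
    exact eval_ne_zero_of_squarefree (S := X - C α) hsqP (by rw [hP₁, hQ]; ring)

/-- **`1/√F` is integrable on a bounded component of `{F > 0}` with (simple) root end points**,
over `ℝ`: `1/√F ≤ K^{-1/2}((√(y − α))⁻¹ + (√(β − y))⁻¹)` on `(α, β)`.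
[Lawden 1989, §6.12; Kontsevich–Zagier 2001, §1.1] [folklore] -/
theorem integrableOn_inv_sqrt_aeval {F : ℚ[X]} {α β : ℝ} (hF : Squarefree F) (hab : α < β)
    (hα : aeval α F = 0) (hβ : aeval β F = 0) (hpos : ∀ y ∈ Ioo α β, 0 < aeval y F) :
    IntegrableOn (fun y : ℝ => 1 / Real.sqrt (aeval y F)) (Ioo α β) := by
  obtain ⟨R, hev, hRα, hRβ⟩ := exists_factor hF hab.ne hα hβ
  -- `R > 0` on the open interval (sign of `F`), `R ≠ 0` on the closed interval (simple roots)
  have hRpos : ∀ y ∈ Ioo α β, 0 < R.eval y := fun y hy => by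
    have h := hpos y hy
    rw [hev] at h
    exact (mul_pos_iff_of_pos_left (mul_pos (sub_pos.2 hy.1) (sub_pos.2 hy.2))).mp h
  have hRne : ∀ y ∈ Icc α β, R.eval y ≠ 0 := fun y hy => by
    rcases eq_endpoints_or_mem_Ioo_of_mem_Icc hy with rfl | rfl | h
    exacts [hRα, hRβ, (hRpos y h).ne']
  -- a positive lower bound for `R` on `(α, β)`: the minimum of `|R|` on the compact `[α, β]`
  obtain ⟨m, hm, hmle⟩ : ∃ m : ℝ, 0 < m ∧ ∀ y ∈ Ioo α β, m ≤ R.eval y := by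
    obtain ⟨z, hz, hmin⟩ := isCompact_Icc.exists_isMinOn (nonempty_Icc.2 hab.le)
      (f := fun y => |R.eval y|) (continuous_abs.comp R.continuous).continuousOn
    refine ⟨|R.eval z|, abs_pos.2 (hRne z hz), fun y hy => ?_⟩
    have h1 : |R.eval z| ≤ |R.eval y| := isMinOn_iff.mp hmin y (Ioo_subset_Icc_self hy)
    rwa [abs_of_pos (hRpos y hy)] at h1
  -- the two one-sided lower bounds `F ≥ K (y − α)`, `F ≥ K (β − y)`
  obtain ⟨K, hK, hlow⟩ : ∃ K : ℝ, 0 < K ∧ ∀ y ∈ Ioo α β,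
      (y - α ≤ β - y → K * (y - α) ≤ aeval y F) ∧ (β - y ≤ y - α → K * (β - y) ≤ aeval y F) := by
    refine ⟨m * ((β - α) / 2), mul_pos hm (by linarith), fun y hy => ⟨fun h => ?_, fun h => ?_⟩⟩
    · have hR := hmle y hy
      have key : m * ((β - α) / 2) ≤ R.eval y * (β - y) :=
        mul_le_mul hR (by linarith) (by linarith) (hm.le.trans hR)
      calc m * ((β - α) / 2) * (y - α) ≤ R.eval y * (β - y) * (y - α) :=
            mul_le_mul_of_nonneg_right key (sub_pos.2 hy.1).le
        _ = aeval y F := by rw [hev]; ring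
    · have hR := hmle y hy
      have key : m * ((β - α) / 2) ≤ R.eval y * (y - α) :=
        mul_le_mul hR (by linarith) (by linarith) (hm.le.trans hR)
      calc m * ((β - α) / 2) * (β - y) ≤ R.eval y * (y - α) * (β - y) :=
            mul_le_mul_of_nonneg_right key (sub_pos.2 hy.2).le
        _ = aeval y F := by rw [hev]; ring
  -- domination by the integrable majorant `K^{-1/2}((√(y − α))⁻¹ + (√(β − y))⁻¹)`
  have hmaj : IntegrableOn
      (fun y => (Real.sqrt K)⁻¹ * ((Real.sqrt (y - α))⁻¹ + (Real.sqrt (β - y))⁻¹)) (Ioo α β) :=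
    ((KZ.integrableOn_inv_sqrt_sub_left _ _).add
      (KZ.integrableOn_inv_sqrt_sub_right _ _)).const_mul _
  simp only [one_div]
  refine Integrable.mono' hmaj ?_ ?_
  · exact ((Polynomial.continuous_aeval F).sqrt.measurable.inv).aestronglyMeasurable
  · filter_upwards [ae_restrict_mem measurableSet_Ioo] with y hy
    obtain ⟨h₁, h₂⟩ := hy
    rw [Real.norm_of_nonneg (inv_nonneg.2 (Real.sqrt_nonneg _))]
    have hA : 0 ≤ (Real.sqrt (y - α))⁻¹ := inv_nonneg.2 (Real.sqrt_nonneg _)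
    have hB : 0 ≤ (Real.sqrt (β - y))⁻¹ := inv_nonneg.2 (Real.sqrt_nonneg _)
    have hKi : 0 ≤ (Real.sqrt K)⁻¹ := inv_nonneg.2 (Real.sqrt_nonneg _)
    rcases le_total (y - α) (β - y) with h | h
    · have hfx := ((hlow y ⟨h₁, h₂⟩).1 h)
      calc (Real.sqrt (aeval y F))⁻¹ ≤ (Real.sqrt (K * (y - α)))⁻¹ :=
            inv_anti₀ (Real.sqrt_pos.2 (mul_pos hK (sub_pos.2 h₁))) (Real.sqrt_le_sqrt hfx)
        _ = (Real.sqrt K)⁻¹ * (Real.sqrt (y - α))⁻¹ := by rw [Real.sqrt_mul hK.le, mul_inv]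
        _ ≤ (Real.sqrt K)⁻¹ * ((Real.sqrt (y - α))⁻¹ + (Real.sqrt (β - y))⁻¹) :=
            mul_le_mul_of_nonneg_left (le_add_of_nonneg_right hB) hKi
    · have hfx := ((hlow y ⟨h₁, h₂⟩).2 h)
      calc (Real.sqrt (aeval y F))⁻¹ ≤ (Real.sqrt (K * (β - y)))⁻¹ :=
            inv_anti₀ (Real.sqrt_pos.2 (mul_pos hK (sub_pos.2 h₂))) (Real.sqrt_le_sqrt hfx)
        _ = (Real.sqrt K)⁻¹ * (Real.sqrt (β - y))⁻¹ := by rw [Real.sqrt_mul hK.le, mul_inv]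
        _ ≤ (Real.sqrt K)⁻¹ * ((Real.sqrt (y - α))⁻¹ + (Real.sqrt (β - y))⁻¹) :=
            mul_le_mul_of_nonneg_left (le_add_of_nonneg_left hA) hKi

/-- **Stub B (`stub_invSqrtIntegrable`) — `dx/√F` converges on a bounded component.** For a
squarefree `F ∈ ℚ[X]`, positive on `(α, β)` and vanishing at both (necessarily simple) end points,
`1/√F` is integrable on `(α, β)`, read in `ℝ¹ = Fin 1 → ℝ` (transport of
`integrableOn_inv_sqrt_aeval` along the measure-preserving `x ↦ x 0`).
[Lawden 1989, §6.12; Kontsevich–Zagier 2001, §1.1] [folklore] -/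
theorem stub_invSqrtIntegrable : ∀ (F : ℚ[X]) (α β : ℝ), Squarefree F → α < β →
    aeval α F = 0 → aeval β F = 0 → (∀ y ∈ Ioo α β, 0 < aeval y F) →
    IntegrableOn (fun x : Fin 1 → ℝ => 1 / Real.sqrt (aeval (x 0) F)) {x | x 0 ∈ Ioo α β} := by
  intro F α β hF hab hα hβ hpos
  -- transport `ℝ → ℝ¹` along `x ↦ x 0` (`MeasurableEquiv.funUnique`, measure preserving)
  exact ((volume_preserving_funUnique (Fin 1) ℝ).integrableOn_comp_preimage
    (MeasurableEquiv.funUnique (Fin 1) ℝ).measurableEmbedding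
    (f := fun y => 1 / Real.sqrt (aeval y F)) (s := Ioo α β)).2
    (integrableOn_inv_sqrt_aeval hF hab hα hβ hpos)

end Summit.KontsevichZagierPeriods.IsogenyCertificates.BiellipticRealPeriodCellStubs.InvSqrtIntegrable

end
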